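import Literature.Analysis.FluidPDE.NSEnstrophyBalance2DGalerkin
import HarnessLib

/-!
# Navier–Stokes on `T^d`: one global Galerkin trajectory with a steady force (field level)

Trunk: FluidKinetic (`Literature/Analysis/FluidPDE`). Definition request `defn-IsGalerkinTrajectory`
(route `Summits/AnomalousDissipation/…/Theses/WazewskiBlock`, items 1730–1735, which inline the
conjunction below five times).

* `NS.Torus.IsGalerkinTrajectory ν f N U` — `U : [0, ∞) → (T^d → ℝ^d)` is ONE global solution of
  the Galerkin system of order `N` (Fourier ball `|k|² ≤ N²`) of the Navier–Stokes equations with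
  viscosity `ν`, driven by the STEADY force `f`, recorded at the level of fields through exactly
  the per-index clauses of the accepted `NS.IsHopfGalerkinScheme` (`NSHopfGalerkin`) minus its
  sequence/datum/force-approximation fields: joint continuity on `[0, ∞) × T^d`, slices in the
  Galerkin class `NS.IsGalerkinMode N` and weakly divergence free, the Galerkin equations tested
  against every Galerkin mode of order `N` and integrated in time, and the exact energy identity
  (Robinson–Rodrigo–Sadowski 2016, Def. 4.2 and (4.2), p. 72, Thm. 4.4 Steps 1–2, (4.3)–(4.7),
  pp. 73–75; Constantin–Foias 1988, Ch. 8, (8.3)–(8.7), pp. 42–43: "if the function `g_m` … is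
  time independent the system is autonomous").
* `NS.Torus.isGalerkinTrajectory_iff` — the predicate is the four-clause conjunction verbatim as
  inlined in the route file.
* `NS.Torus.IsGalerkinTrajectory.of_isGalerkinMode` — the weak divergence-free clause is automatic
  (smooth and divergence free ⇒ weakly divergence free);
  `NS.Torus.IsGalerkinTrajectory.comp_add_right` — time-translation invariance (autonomous system).
* `NS.IsHopfGalerkinScheme.isGalerkinTrajectory` — every member of a Hopf–Galerkin scheme with the
  steady force `F n = f` is a Galerkin trajectory of order `N n`.
* `NS.Torus.IsGalerkinTrajectory.force_congr`, `…_fourierTruncate_iff` — only the pairings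
  `⟪f, a⟫` with Galerkin modes `a` of order `N` enter, so the force may be replaced by any `L²`
  field with the same Galerkin projection, in particular by `P_N f` (RRS 2016, p. 74:
  "`⟨P_n v, a_k⟩ = ⟨v, a_k⟩`").
* `NS.IsGalerkinTrajectory.torus_fourierTruncate`, `NS.IsGalerkinTrajectory.torus` — the bridge
  from the tree's coefficient-level trajectories `NS.IsGalerkinTrajectory ν (freqBall N) f u₀ α`
  (`NSEnstrophyBalance2DGalerkin`: the Galerkin ODE `α' = galerkinRHS …`) to the field level:
  `galerkinVelocity (freqBall N) α` is a Galerkin trajectory of order `N` (the tree's dictionary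
  `NS.galerkin_test_identity`, `NS.galerkin_energy_identity`, `NS.galerkin_slice_props`).
* `NS.Torus.exists_isGalerkinTrajectory_of_isGalerkinMode` (and `…coeff…`) — for `ν ≥ 0`, `f ∈ L²` and every Galerkin mode `a` of
  order `N` there is a Galerkin trajectory of order `N` with `U 0 = a` (global existence for the
  Galerkin ODE, `NS.exists_galerkin_solution`, through `NS.exists_isGalerkinTrajectory`).

## Mathlib / tree search

Mathlib (this pin) has no Navier–Stokes or Galerkin theory (searched `Galerkin`, `NavierStokes`).
In the tree, `NS.IsGalerkinTrajectory` (`NSEnstrophyBalance2DGalerkin`) is the COEFFICIENT-level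
notion (`α : ℝ → (S → ℂ^d)` solving the Galerkin ODE) — the name is therefore taken, and the
field-level predicate requested by the route is placed next to `Torus.IsLerayHopfOn`,
`Torus.IsGlobalLerayHopf` as `Torus.IsGalerkinTrajectory`; `NS.exists_steady_galerkin_scheme`
(`NSGalerkinSteadyScheme`) packages the steady-force approximations as an `IsHopfGalerkinScheme`
with the TRUNCATED force `P_n f`, whence the `force_congr` lemmas here.

## References

* J. C. Robinson, J. L. Rodrigo, W. Sadowski, *The three-dimensional Navier–Stokes equations*,
  CUP 2016, §4.1 (Lemma 4.1, Def. 4.2, (4.2)), Thm. 4.4 Steps 1–2, (4.3)–(4.8), pp. 71–75.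
  [RobinsonRodrigoSadowski2016]
* P. Constantin, C. Foias, *Navier–Stokes Equations*, Chicago 1988, Ch. 8, (8.1)–(8.9),
  pp. 42–43. [ConstantinFoias1988]
* E. Hopf, Math. Nachr. 4 (1951), 213–231, §2. [Hopf1951]
-/

noncomputable section

open MeasureTheory TopologicalSpace Set Function Filter Topology UnitAddTorus
open scoped InnerProductSpace RealInnerProductSpace ENNReal NNReal

namespace Literature.Analysis.FluidPDE

open FunctionSpaces.Torus Torus

variable {d : Type*} [Fintype d] [DecidableEq d]

/-! ### The field-level predicate -/

section Defn

/-- **A global Galerkin trajectory of order `N` with a steady force** (field level). For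
viscosity `ν`, a steady force `f : T^d → ℝ^d` and an order `N`, the field
`U : ℝ → (T^d → ℝ^d)` (only `t ≥ 0` matters) is a global solution of the `N`-th Galerkin system
of the Navier–Stokes equations — `∂ₜu_N + νAu_N + P_N[(u_N·∇)u_N] = P_N f`
(Robinson–Rodrigo–Sadowski 2016, Def. 4.2, with the force of Constantin–Foias 1988, (8.3):
`du_m/dt + νAu_m + P_m B(u_m,u_m) = g_m`, `g_m = P_m f` time independent) — recorded through
exactly the per-index clauses of `IsHopfGalerkinScheme`:
* `U` is jointly continuous on `[0, ∞) × T^d`;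
* every slice `U t`, `t ≥ 0`, is a Galerkin mode of order `N` (smooth, divergence free,
  band-limited to `|k|² ≤ N²`) and weakly divergence free;
* the **Galerkin equations** tested against every Galerkin mode `a` of order `N` and integrated in
  time, `⟪U t, a⟫ - ⟪U s, a⟫ = ∫ₛᵗ ∫ (⟪U, (U·∇)a⟫ + ν⟪U, Δa⟫ + ⟪f, a⟫)` for `0 ≤ s ≤ t`
  (RRS (4.2)/(4.5) paired with `a`, `⟪(u·∇)u, a⟫ = -⟪u, (u·∇)a⟫`; CF (8.5));
* the **exact energy identity** `½‖U t‖² + ν∫ₛᵗ‖∇U‖² = ½‖U s‖² + ∫ₛᵗ ⟪f, U⟫`, `0 ≤ s ≤ t`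
  (RRS (4.6)–(4.7); CF (8.7)), the dissipation measured by the spectral `eGradNormSq`.
Only the pairings of `f` with Galerkin modes of order `N` enter, so `f` and `P_N f` define the
same trajectories (`IsGalerkinTrajectory.force_congr`). [cite: RobinsonRodrigoSadowski2016, Thm. 4.4 Steps 1–2, (4.2), (4.5)–(4.7)] [cite: ConstantinFoias1988, Ch. 8 (8.3)–(8.7)] -/
structure Torus.IsGalerkinTrajectory (ν : ℝ) (f : UnitAddTorus d → EuclideanSpace ℝ d) (N : ℕ)
    (U : ℝ → UnitAddTorus d → EuclideanSpace ℝ d) : Prop where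
  /-- `U` is jointly continuous on `[0, ∞) × T^d`. -/
  continuousOn : ContinuousOn (stLift U) (Ici 0 ×ˢ univ)
  /-- Every slice `U t`, `t ≥ 0`, is a Galerkin mode of order `N`. -/
  isGalerkinMode : ∀ t, 0 ≤ t → IsGalerkinMode N (U t)
  /-- Every slice `U t`, `t ≥ 0`, is weakly divergence free. -/
  isWeaklyDivFree : ∀ t, 0 ≤ t → FunctionSpaces.Torus.IsWeaklyDivFree (U t)
  /-- The Galerkin equations with the steady force `f`, tested against Galerkin modes of order `N`
  and integrated in time (RRS 2016, (4.2)/(4.5); CF 1988, (8.5)). -/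
  galerkin : ∀ a : UnitAddTorus d → EuclideanSpace ℝ d, IsGalerkinMode N a →
    ∀ s t : ℝ, 0 ≤ s → s ≤ t →
      (∫ x, ⟪U t x, a x⟫) - ∫ x, ⟪U s x, a x⟫ =
        ∫ τ in s..t, ∫ x, (⟪U τ x, FunctionSpaces.Torus.convect (U τ) a x⟫ +
          ν * ⟪U τ x, FunctionSpaces.Torus.laplacian a x⟫ + ⟪f x, a x⟫)
  /-- The exact energy identity on every `[s, t] ⊆ [0, ∞)` (RRS 2016, (4.6)–(4.7); CF 1988, (8.7)). -/
  energy_eq : ∀ s t : ℝ, 0 ≤ s → s ≤ t →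
    kineticEnergy (U t) + ν * (∫⁻ τ in Ioo s t, eGradNormSq (U τ)).toReal =
      kineticEnergy (U s) + ∫ τ in s..t, ∫ x, ⟪f x, U τ x⟫

/-- `Torus.IsGalerkinTrajectory` is, verbatim, the four-clause conjunction inlined in the route
`WazewskiBlock` (continuity; Galerkin-mode and weakly divergence-free slices; tested Galerkin
equations; energy identity). [folklore] -/
theorem Torus.isGalerkinTrajectory_iff {ν : ℝ} {f : UnitAddTorus d → EuclideanSpace ℝ d} {N : ℕ}
    {U : ℝ → UnitAddTorus d → EuclideanSpace ℝ d} :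
    Torus.IsGalerkinTrajectory ν f N U ↔
      ContinuousOn (stLift U) (Ici 0 ×ˢ univ) ∧
      (∀ t : ℝ, 0 ≤ t → IsGalerkinMode N (U t) ∧ FunctionSpaces.Torus.IsWeaklyDivFree (U t)) ∧
      (∀ a : UnitAddTorus d → EuclideanSpace ℝ d, IsGalerkinMode N a → ∀ s t : ℝ, 0 ≤ s → s ≤ t →
        (∫ x, ⟪U t x, a x⟫) - ∫ x, ⟪U s x, a x⟫ =
          ∫ τ in s..t, ∫ x, (⟪U τ x, FunctionSpaces.Torus.convect (U τ) a x⟫ +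
            ν * ⟪U τ x, FunctionSpaces.Torus.laplacian a x⟫ + ⟪f x, a x⟫)) ∧
      (∀ s t : ℝ, 0 ≤ s → s ≤ t →
        kineticEnergy (U t) + ν * (∫⁻ τ in Ioo s t, eGradNormSq (U τ)).toReal =
          kineticEnergy (U s) + ∫ τ in s..t, ∫ x, ⟪f x, U τ x⟫) :=
  ⟨fun h => ⟨h.continuousOn, fun t ht => ⟨h.isGalerkinMode t ht, h.isWeaklyDivFree t ht⟩, h.galerkin,
    h.energy_eq⟩,
    fun h => ⟨h.1, fun t ht => (h.2.1 t ht).1, fun t ht => (h.2.1 t ht).2, h.2.2.1, h.2.2.2⟩⟩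

/-- The weak divergence-free clause is automatic: a constructor for `Torus.IsGalerkinTrajectory`
from continuity, Galerkin-mode slices, the tested Galerkin equations and the energy identity
(a Galerkin mode is smooth and divergence free, hence weakly divergence free,
`IsDivFree.isWeaklyDivFree_holds`). [folklore] -/
theorem Torus.IsGalerkinTrajectory.of_isGalerkinMode {ν : ℝ} {f : UnitAddTorus d → EuclideanSpace ℝ d}
    {N : ℕ} {U : ℝ → UnitAddTorus d → EuclideanSpace ℝ d}
    (hcont : ContinuousOn (stLift U) (Ici 0 ×ˢ univ)) (hmode : ∀ t, 0 ≤ t → IsGalerkinMode N (U t))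
    (hgal : ∀ a : UnitAddTorus d → EuclideanSpace ℝ d, IsGalerkinMode N a → ∀ s t : ℝ, 0 ≤ s → s ≤ t →
      (∫ x, ⟪U t x, a x⟫) - ∫ x, ⟪U s x, a x⟫ =
        ∫ τ in s..t, ∫ x, (⟪U τ x, FunctionSpaces.Torus.convect (U τ) a x⟫ +
          ν * ⟪U τ x, FunctionSpaces.Torus.laplacian a x⟫ + ⟪f x, a x⟫))
    (hE : ∀ s t : ℝ, 0 ≤ s → s ≤ t →
      kineticEnergy (U t) + ν * (∫⁻ τ in Ioo s t, eGradNormSq (U τ)).toReal =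
        kineticEnergy (U s) + ∫ τ in s..t, ∫ x, ⟪f x, U τ x⟫) :
    Torus.IsGalerkinTrajectory ν f N U :=
  ⟨hcont, hmode, fun t ht => (hmode t ht).isDivFree.isWeaklyDivFree_holds (hmode t ht).isSmooth,
    hgal, hE⟩

end Defn

/-! ### Elementary API -/

namespace Torus.IsGalerkinTrajectory

variable {ν : ℝ} {f : UnitAddTorus d → EuclideanSpace ℝ d} {N : ℕ}
  {U : ℝ → UnitAddTorus d → EuclideanSpace ℝ d}

/-- Slices of a Galerkin trajectory are smooth. [folklore] -/
theorem isSmooth (h : Torus.IsGalerkinTrajectory ν f N U) {t : ℝ} (ht : 0 ≤ t) : IsSmooth (U t) :=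
  (h.isGalerkinMode t ht).isSmooth

/-- Slices of a Galerkin trajectory are (classically) divergence free. [folklore] -/
theorem isDivFree (h : Torus.IsGalerkinTrajectory ν f N U) {t : ℝ} (ht : 0 ≤ t) :
    FunctionSpaces.Torus.IsDivFree (U t) :=
  (h.isGalerkinMode t ht).isDivFree

/-- Slices of a Galerkin trajectory have no Fourier modes outside the ball `|k|² ≤ N²`. [folklore] -/
theorem mFourierCoeff_eq_zero (h : Torus.IsGalerkinTrajectory ν f N U) {t : ℝ} (ht : 0 ≤ t)
    {k : d → ℤ} (hk : (N : ℝ) ^ 2 < freqNormSq k) :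
    mFourierCoeff (FunctionSpaces.EuclideanSpace.complexify ∘ U t) k = 0 :=
  (h.isGalerkinMode t ht).mFourierCoeff_eq_zero hk

/-- Slices of a Galerkin trajectory are in every `L^p`. [folklore] -/
theorem memLp (h : Torus.IsGalerkinTrajectory ν f N U) {t : ℝ} (ht : 0 ≤ t) (p : ℝ≥0∞) :
    MemLp (U t) p volume :=
  (h.isSmooth ht).memLp p

/-- Slices of a Galerkin trajectory are their own Fourier truncations: `P_N (U t) = U t`. [folklore] -/
theorem fourierTruncate_slice (h : Torus.IsGalerkinTrajectory ν f N U) {t : ℝ} (ht : 0 ≤ t) :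
    fourierTruncate N (U t) = U t :=
  fourierTruncate_eq_self (h.isSmooth ht).continuous fun _ hk => h.mFourierCoeff_eq_zero ht hk

/-- The energy identity from `s = 0`: `½‖U t‖² + ν∫₀ᵗ‖∇U‖² = ½‖U 0‖² + ∫₀ᵗ⟪f, U⟫`. [folklore] -/
theorem energy_eq_zero (h : Torus.IsGalerkinTrajectory ν f N U) {t : ℝ} (ht : 0 ≤ t) :
    kineticEnergy (U t) + ν * (∫⁻ τ in Ioo 0 t, eGradNormSq (U τ)).toReal =
      kineticEnergy (U 0) + ∫ τ in (0 : ℝ)..t, ∫ x, ⟪f x, U τ x⟫ :=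
  h.energy_eq 0 t le_rfl ht

/-- **Time-translation invariance.** With a steady force the Galerkin system is autonomous
(Constantin–Foias 1988, Ch. 8, p. 43: "if … `g_m` [is] time independent the system is
autonomous"): if `U` is a Galerkin trajectory of order `N`, so is `t ↦ U (t + t₀)` for every
`t₀ ≥ 0` (all four clauses are invariant under `τ ↦ τ + t₀`; the time integrals by
`intervalIntegral.integral_comp_add_right` and translation invariance of Lebesgue measure). [cite: ConstantinFoias1988, Ch. 8 (8.3)–(8.7)] -/
theorem comp_add_right (h : Torus.IsGalerkinTrajectory ν f N U) {t₀ : ℝ} (ht₀ : 0 ≤ t₀) :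
    Torus.IsGalerkinTrajectory ν f N (fun t => U (t + t₀)) where
  continuousOn := by
    have hc : Continuous fun p : ℝ × EuclideanSpace ℝ d => (p.1 + t₀, p.2) :=
      (continuous_fst.add continuous_const).prodMk continuous_snd
    have hmap : MapsTo (fun p : ℝ × EuclideanSpace ℝ d => (p.1 + t₀, p.2)) (Ici 0 ×ˢ univ)
        (Ici (0 : ℝ) ×ˢ (univ : Set (EuclideanSpace ℝ d))) :=
      fun p hp => ⟨add_nonneg (mem_Ici.1 hp.1) ht₀, mem_univ _⟩
    exact (h.continuousOn.comp hc.continuousOn hmap).congr fun p _ => rfl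
  isGalerkinMode t ht := h.isGalerkinMode (t + t₀) (add_nonneg ht ht₀)
  isWeaklyDivFree t ht := h.isWeaklyDivFree (t + t₀) (add_nonneg ht ht₀)
  galerkin a ha s t hs hst := by
    rw [h.galerkin a ha (s + t₀) (t + t₀) (add_nonneg hs ht₀) (by linarith),
      ← intervalIntegral.integral_comp_add_right]
  energy_eq s t hs hst := by
    have hl := (measurePreserving_add_right (volume : Measure ℝ) t₀).setLIntegral_comp_emb
      (measurableEmbedding_addRight t₀) (fun τ => eGradNormSq (U τ)) (Ioo s t)
    rw [image_add_const_Ioo] at hl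
    rw [hl, h.energy_eq (s + t₀) (t + t₀) (add_nonneg hs ht₀) (by linarith),
      ← intervalIntegral.integral_comp_add_right]

end Torus.IsGalerkinTrajectory

/-! ### Hopf–Galerkin schemes with a steady force consist of Galerkin trajectories -/

/-- Every member of a Hopf–Galerkin scheme (`IsHopfGalerkinScheme`) whose approximate forces are the
steady force itself, `F n t = f`, is a Galerkin trajectory of order `N n` with force `f`
(projection of the per-index clauses). [folklore] -/
theorem IsHopfGalerkinScheme.isGalerkinTrajectory {ν : ℝ} {f u₀ : UnitAddTorus d → EuclideanSpace ℝ d}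
    {N : ℕ → ℕ} {U : ℕ → ℝ → UnitAddTorus d → EuclideanSpace ℝ d}
    (h : IsHopfGalerkinScheme ν (fun _ => f) u₀ N (fun _ _ => f) U) (n : ℕ) :
    Torus.IsGalerkinTrajectory ν f (N n) (U n) where
  continuousOn := h.continuousOn n
  isGalerkinMode := h.isGalerkinMode n
  isWeaklyDivFree := h.isWeaklyDivFree n
  galerkin := h.galerkin n
  energy_eq := h.energy_eq n

/-! ### Only the Galerkin projection of the force matters -/

section Force

omit [DecidableEq d] in
/-- Pairings of an `L²` field with a smooth field are integrable on the (compact) torus. [folklore] -/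
theorem Torus.integrable_inner_of_memLp_of_isSmooth {f a : UnitAddTorus d → EuclideanSpace ℝ d}
    (hf : MemLp f 2 volume) (ha : IsSmooth a) : Integrable (fun x => ⟪f x, a x⟫) volume := by
  obtain ⟨C, hC⟩ := isCompact_univ.exists_bound_of_continuousOn (ha.continuous.continuousOn (s := univ))
  refine Integrable.mono' (((hf.integrable one_le_two).norm).mul_const C)
    (hf.1.inner ha.continuous.aestronglyMeasurable) (ae_of_all _ fun x => ?_)
  calc ‖⟪f x, a x⟫‖ ≤ ‖f x‖ * ‖a x‖ := norm_inner_le_norm _ _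
    _ ≤ ‖f x‖ * C := mul_le_mul_of_nonneg_left (hC x (mem_univ x)) (norm_nonneg _)

variable {ν : ℝ} {f f' : UnitAddTorus d → EuclideanSpace ℝ d} {N : ℕ}
  {U : ℝ → UnitAddTorus d → EuclideanSpace ℝ d}

/-- **Only `P_N f` enters.** If two `L²` forces have the same pairings with every Galerkin mode of
order `N`, they define the same Galerkin trajectories of order `N` (the force is only ever paired
with Galerkin modes: the test fields `a` and the slices `U τ`; Robinson–Rodrigo–Sadowski 2016,
p. 74: "`⟨P_n v, a_k⟩ = ⟨v, a_k⟩` for every `v ∈ L²`"). [cite: RobinsonRodrigoSadowski2016, Thm. 4.4 Step 1] -/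
theorem Torus.IsGalerkinTrajectory.force_congr (h : Torus.IsGalerkinTrajectory ν f N U)
    (hf : MemLp f 2 volume) (hf' : MemLp f' 2 volume)
    (hff' : ∀ a : UnitAddTorus d → EuclideanSpace ℝ d, IsGalerkinMode N a →
      ∫ x, ⟪f x, a x⟫ = ∫ x, ⟪f' x, a x⟫) :
    Torus.IsGalerkinTrajectory ν f' N U where
  continuousOn := h.continuousOn
  isGalerkinMode := h.isGalerkinMode
  isWeaklyDivFree := h.isWeaklyDivFree
  galerkin a ha s t hs hst := by
    rw [h.galerkin a ha s t hs hst]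
    refine intervalIntegral.integral_congr fun τ hτ => ?_
    rw [uIcc_of_le hst] at hτ
    have hU : IsSmooth (U τ) := h.isSmooth (hs.trans hτ.1)
    have hA : IsSmooth fun x => ⟪U τ x, FunctionSpaces.Torus.convect (U τ) a x⟫ :=
      hU.inner (hU.convect ha.isSmooth)
    have hB : IsSmooth fun x => ν * ⟪U τ x, FunctionSpaces.Torus.laplacian a x⟫ :=
      (isSmooth_const (d := d) ν).smul' (hU.inner ha.isSmooth.laplacian)
    have hAB : Integrable (fun x => ⟪U τ x, FunctionSpaces.Torus.convect (U τ) a x⟫ +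
        ν * ⟪U τ x, FunctionSpaces.Torus.laplacian a x⟫) volume :=
      hA.integrable.add hB.integrable
    rw [integral_add hAB (Torus.integrable_inner_of_memLp_of_isSmooth hf ha.isSmooth),
      integral_add hAB (Torus.integrable_inner_of_memLp_of_isSmooth hf' ha.isSmooth), hff' a ha]
  energy_eq s t hs hst := by
    rw [h.energy_eq s t hs hst]
    congr 1
    refine intervalIntegral.integral_congr fun τ hτ => ?_
    rw [uIcc_of_le hst] at hτ
    exact hff' (U τ) (h.isGalerkinMode τ (hs.trans hτ.1))

/-- Two `L²` forces with the same Galerkin pairings of order `N` define the same Galerkin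
trajectories of order `N` (symmetric form of `force_congr`). [folklore] -/
theorem Torus.isGalerkinTrajectory_congr_force (hf : MemLp f 2 volume) (hf' : MemLp f' 2 volume)
    (hff' : ∀ a : UnitAddTorus d → EuclideanSpace ℝ d, IsGalerkinMode N a →
      ∫ x, ⟪f x, a x⟫ = ∫ x, ⟪f' x, a x⟫) :
    Torus.IsGalerkinTrajectory ν f N U ↔ Torus.IsGalerkinTrajectory ν f' N U :=
  ⟨fun h => h.force_congr hf hf' hff', fun h => h.force_congr hf' hf fun a ha => (hff' a ha).symm⟩

/-- **The force may be replaced by its Galerkin truncation**: for `f ∈ L²`,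
`U` is a Galerkin trajectory of order `N` for `P_N f` iff it is one for `f`
(`integral_inner_fourierTruncate_eq`: `⟪P_N f, a⟫ = ⟪f, a⟫` on band-limited `a`). This matches the
tree's `exists_steady_galerkin_scheme`, whose approximate forces are `P_n f`. [cite: RobinsonRodrigoSadowski2016, §4.1] -/
theorem Torus.isGalerkinTrajectory_fourierTruncate_iff (hf : MemLp f 2 volume) :
    Torus.IsGalerkinTrajectory ν (fourierTruncate N f) N U ↔ Torus.IsGalerkinTrajectory ν f N U :=
  Torus.isGalerkinTrajectory_congr_force (memLp_fourierTruncate N f 2) hf fun _ ha =>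
    integral_inner_fourierTruncate_eq hf (ha.isSmooth.memLp 2) fun _ hk =>
      ha.mFourierCoeff_eq_zero (not_mem_freqBall.1 hk)

end Force

/-! ### From the coefficient-level Galerkin ODE to the field level -/

section Bridge

variable {ν : ℝ} {N : ℕ} {f u₀ : UnitAddTorus d → EuclideanSpace ℝ d}
  {α : ℝ → ↥(freqBall (d := d) N) → EuclideanSpace ℂ d}

/-- **Coefficient trajectories are field trajectories, truncated force.** If `α` solves the
Galerkin ODE of order `freqBall N` driven by the steady coefficients `f̂|_{|k| ≤ N}` from `P_N u₀`
(`IsGalerkinTrajectory ν (freqBall N) f u₀ α`, the tree's coefficient-level notion) and `f ∈ L²`,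
then the velocity `U t = realTrigPoly (freqBall N) (α t)` is a field-level Galerkin trajectory of
order `N` for the truncated force `P_N f` — the tree's dictionary `galerkin_test_identity`,
`galerkin_energy_identity`, `galerkin_slice_props`, `continuousOn_stLift_realTrigPoly`
(Robinson–Rodrigo–Sadowski 2016, Thm. 4.4 Steps 1–2). [cite: RobinsonRodrigoSadowski2016, Thm. 4.4 Steps 1–2] -/
theorem IsGalerkinTrajectory.torus_fourierTruncate (h : IsGalerkinTrajectory ν (freqBall N) f u₀ α)
    (hf : MemLp f 2 volume) :
    Torus.IsGalerkinTrajectory ν (fourierTruncate N f) N (galerkinVelocity (freqBall N) α) := by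
  have hgr : ∀ _t : ℝ, IsRealCoeff (fourierRestrict (freqBall N) f) := fun _ =>
    isRealCoeff_mFourierCoeff (hf.integrable one_le_two)
  -- the truncated force is the real trigonometric polynomial of the restricted coefficients
  have hF : realTrigPoly (freqBall N) (coeffExt (freqBall N) (fourierRestrict (freqBall N) f)) =
      fourierTruncate N f := by
    rw [FunctionSpaces.Torus.fourierTruncate_eq]
    exact realTrigPoly_congr fun k hk => by rw [coeffExt_of_mem _ hk, fourierRestrict_apply]
  have hband : ∀ {a : UnitAddTorus d → EuclideanSpace ℝ d}, IsGalerkinMode N a →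
      ∀ k ∉ freqBall (d := d) N, mFourierCoeff (FunctionSpaces.EuclideanSpace.complexify ∘ a) k = 0 :=
    fun ha k hk => ha.mFourierCoeff_eq_zero (not_mem_freqBall.1 hk)
  refine
    { continuousOn := h.continuousOn_stLift
      isGalerkinMode := fun t _ => ?_
      isWeaklyDivFree := fun t _ => h.isWeaklyDivFree t
      galerkin := fun a ha s t hs hst => ?_
      energy_eq := fun s t hs hst => ?_ }
  · have hp := galerkin_slice_props h.symm (h.mem t)
    exact ⟨hp.1, hp.2.1, fun k hk => hp.2.2.2 k (not_mem_freqBall.2 hk)⟩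
  · have hid := galerkin_test_identity ν h.symm (g := fun _ => fourierRestrict (freqBall N) f)
      continuous_const hgr h.mem h.hasDerivWithinAt ha.isSmooth ha.isDivFree (hband ha) hs hst
    simpa only [galerkinVelocity_apply, hF] using hid
  · have hid := galerkin_energy_identity ν h.symm (g := fun _ => fourierRestrict (freqBall N) f)
      continuous_const hgr h.mem h.hasDerivWithinAt hs hst
    simpa only [galerkinVelocity_apply, hF] using hid

/-- **Coefficient trajectories are field trajectories.** Under the hypotheses of
`IsGalerkinTrajectory.torus_fourierTruncate`, `galerkinVelocity (freqBall N) α` is a field-level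
Galerkin trajectory of order `N` for the force `f` itself (`force_congr`: `⟪P_N f, a⟫ = ⟪f, a⟫` on
Galerkin modes). [cite: RobinsonRodrigoSadowski2016, Thm. 4.4 Steps 1–2] -/
theorem IsGalerkinTrajectory.torus (h : IsGalerkinTrajectory ν (freqBall N) f u₀ α)
    (hf : MemLp f 2 volume) :
    Torus.IsGalerkinTrajectory ν f N (galerkinVelocity (freqBall N) α) :=
  (Torus.isGalerkinTrajectory_fourierTruncate_iff hf).1 (h.torus_fourierTruncate hf)

/-- The initial velocity of a coefficient trajectory is the truncated datum:
`galerkinVelocity (freqBall N) α 0 = P_N u₀`. [folklore] -/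
theorem IsGalerkinTrajectory.galerkinVelocity_zero (h : IsGalerkinTrajectory ν (freqBall N) f u₀ α) :
    galerkinVelocity (freqBall N) α 0 = fourierTruncate N u₀ := by
  rw [galerkinVelocity_apply, h.initial, FunctionSpaces.Torus.fourierTruncate_eq]
  exact realTrigPoly_congr fun k hk => by rw [coeffExt_of_mem _ hk, fourierRestrict_apply]

end Bridge

/-! ### Existence from every Galerkin-mode datum -/

section Existence

/-- **Global Galerkin trajectories exist from every Galerkin-mode datum** (Robinson–Rodrigo–
Sadowski 2016, Thm. 4.4 Steps 1–2, pp. 73–75: the right-hand side of (4.5) is locally Lipschitz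
and the energy identity (4.6) rules out blow-up, "hence `T_n = ∞`"; Constantin–Foias 1988, Ch. 8,
(8.5)–(8.7)). For `ν ≥ 0`, `f ∈ L²(T^d; ℝ^d)` and a Galerkin mode `a` of order `N` there is a
field-level Galerkin trajectory `U` of order `N` with force `f` and `U 0 = a`: the velocity of the
tree's coefficient trajectory (`exists_isGalerkinTrajectory`, from `exists_galerkin_solution`)
issued from `â|_{|k| ≤ N}`, whose initial slice `P_N a` equals `a` because `a` is band-limited
(`fourierTruncate_eq_self`). [cite: RobinsonRodrigoSadowski2016, Thm. 4.4 Steps 1–2] -/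
theorem Torus.exists_isGalerkinTrajectory_of_isGalerkinMode {ν : ℝ} (hν : 0 ≤ ν) {N : ℕ}
    {f a : UnitAddTorus d → EuclideanSpace ℝ d} (hf : MemLp f 2 volume) (ha : IsGalerkinMode N a) :
    ∃ U : ℝ → UnitAddTorus d → EuclideanSpace ℝ d, Torus.IsGalerkinTrajectory ν f N U ∧ U 0 = a := by
  obtain ⟨α, hα⟩ := exists_isGalerkinTrajectory hν (neg_mem_freqBall_of_mem (N := N))
    (hf.integrable one_le_two) (ha.isSmooth.memLp 2) (ha.isDivFree.isWeaklyDivFree_holds ha.isSmooth)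
  refine ⟨galerkinVelocity (freqBall N) α, hα.torus hf, ?_⟩
  rw [hα.galerkinVelocity_zero]
  exact fourierTruncate_eq_self ha.isSmooth.continuous fun _ hk => ha.mFourierCoeff_eq_zero hk

/-- Existence in coefficient form, for users who need the ODE as well (e.g. to define the
Galerkin semiflow): for `ν ≥ 0`, `f ∈ L²` and a Galerkin mode `a` of order `N` there is a
coefficient trajectory `α` of order `freqBall N` from `a` whose velocity is a field-level Galerkin
trajectory with `galerkinVelocity (freqBall N) α 0 = a`. [cite: RobinsonRodrigoSadowski2016, Thm. 4.4 Steps 1–2] -/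
theorem Torus.exists_coeff_isGalerkinTrajectory_of_isGalerkinMode {ν : ℝ} (hν : 0 ≤ ν) {N : ℕ}
    {f a : UnitAddTorus d → EuclideanSpace ℝ d} (hf : MemLp f 2 volume) (ha : IsGalerkinMode N a) :
    ∃ α : ℝ → ↥(freqBall (d := d) N) → EuclideanSpace ℂ d,
      FluidPDE.IsGalerkinTrajectory ν (freqBall N) f a α ∧
      Torus.IsGalerkinTrajectory ν f N (galerkinVelocity (freqBall N) α) ∧
      galerkinVelocity (freqBall N) α 0 = a := by
  obtain ⟨α, hα⟩ := exists_isGalerkinTrajectory hν (neg_mem_freqBall_of_mem (N := N))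
    (hf.integrable one_le_two) (ha.isSmooth.memLp 2) (ha.isDivFree.isWeaklyDivFree_holds ha.isSmooth)
  refine ⟨α, hα, hα.torus hf, ?_⟩
  rw [hα.galerkinVelocity_zero]
  exact fourierTruncate_eq_self ha.isSmooth.continuous fun _ hk => ha.mFourierCoeff_eq_zero hk

end Existence

end Literature.Analysis.FluidPDE
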